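import Summits.BirchSwinnertonDyer.BirchSwinnertonDyer.Theorems.EisensteinPrimesAcTwistDeformationGrSelmerStrictAtShapiro
import Summits.BirchSwinnertonDyer.BirchSwinnertonDyer.Theorems.EisensteinPrimesXAcImprimitiveNoPTorsionOfPoitouTateAt
import Summits.BirchSwinnertonDyer.BirchSwinnertonDyer.Theorems.EisensteinPrimesCharGrSelmerCorankGeOfFacts
import HarnessLib

/-!
# «`𝔛_θ^S` HAS NO `p`-TORSION» for Castella–Grossi–Lee–Skinner's character duals — the ℤ_p-freeness half of CGLS 2022
# Prop. 1.2.5, h411-free, from Milne I 4.10 (a) at totally complex `K` + Greenberg 2006 Props. 4.1 / 4.2 / 3.2 BY NAME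
# and the (f.g., torsion, `μ = 0`) triple (cell `bsd-eis`, width seat `bsd-line-x2-p2` gen 27; crux 4 `BSDpOnCellC`
# stmt-BirchSwinnertonDyer-19034, line telescope v21 UNCHANGED; P3-b of the C2 programme, evidence #59)

WHY. The ONE place where crux 4's v21 cone consumes the DIMENSION clause `#H¹_{𝓕_Gr^S}(K_∞, (F/𝒪)(θ))[p] = p^λ` of the named fact
`CastellaGrossiLeeSkinner2022.prop125_characterGrSelmerDual_torsion_muZero_dim` is
`ResidualDevissageNonsplitLambdaIdentityOfFacts.lambdaInvariant_le_add_of_prop125_of_cor126` (l.195/197), and there only to derive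
«`∀ x : D.X, p • x = 0 → x = 0`» for the strict duals of the two residual characters. This file proves that conclusion DIRECTLY, for
every Teichmüller character `θ` at CGLS's binders, by the road the tree already runs for the CURVE (x2-p2 g18's
`XAcImprimitiveNoPTorsion.xAc_smul_eq_zero_imp_ofPoitouTateAt`): the one-variable twist deformation `𝐃₁(θ) = ℚ_p/ℤ_p ⊗ Λ^*(κ⁻¹)` over
`G_{K,Σ}`, `Σ = {v, v̄} ∪ S` (model `characterRepUnramified`, x1 LEAD g2), has `S_{𝓛^{v̄}}(K, 𝐃₁(θ))` ALMOST `Λ`-DIVISIBLE by the generic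
`AcTwistDeformation.bigRep_strictAtSelmer_isAlmostDivisible_of_dualBasis_ofPoitouTateAt` (rank `n = 1`; Greenberg 2016 Prop. 4.1.1 (c)'s
conclusion fed the textbook Poitou–Tate clause, NOT Prop. 4.1.1 by name), `corank_Λ S_{𝓛^{v̄}} = 0` coming from the cotorsion of the
strict dual (this seat's generic `hasCorank_strictAtSelmer_zero_of_grDualData`); then the generic
`grDualData_eq_zero_of_smul_eq_zero_of_isAlmostDivisible` (Shapiro: `S_{𝓛^{v̄}}(K, 𝐃₁(θ)) ≅ H¹_{𝓕_Gr^S}(K_∞, (F/𝒪)(θ))`; almost divisible ⟹ no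
finite submodule in the dual; `μ = 0` ⟹ no `p`-torsion). REGISTER OF RECORD (doc-fix, F-g168-1 remedy; referee g168 page-check adopted): in CGLS 2022
(published = arXiv v2-final) the structure step in the proof of Prop. 1.2.5 is [Gre89, Prop. 5] + [GV00, Lem. 2.6] + Prop. w = v (iii); the sentence
«`𝔛_θ^S` is a free ℤ_p-module» is explicit only in arXiv:2008.02571v1 (proof of Prop. 14) and was removed in v2/final; CGLS cites no «[Gr5]» and no
Greenberg 2016 — Greenberg 2016 Prop. 4.1.1 (c) is the modern form of the fact, which THIS proof's architecture follows, NOT a source CGLS cites.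

HONEST FRAMING: ONE theorem (no definition, no named fact, no `sorry`, no instance); its published inputs are hypotheses BY NAME, all already
among crux 4's inputs or tree theorems at the head (`hX` = Milne ADT I Thm. 4.10 (a), a TREE THEOREM at totally complex `K`
(`PoitouTateShaNaturalAtTC.forall_poitouTate_shaRestricted_tateDual_natural_at_of_isTotallyComplex`); `h41`/`h42`/`h32` = Greenberg 2006
Props. 4.1 / 4.2 / 3.2, TREE THEOREMS fed at the V21 head); closes no stub, discharges no Literature fact by itself, moves no count (27 names by
name of record); BSD is proved for no curve. With this file the programme's P3 is in tree; P4 (restate `prop125_bc` + re-ports + closure)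
remains before anything is «redundant».

References: [CastellaGrossiLeeSkinner2022] §1.2 Prop. 1.2.5 and proof (arXiv:2008.02571 Prop. 14), Cor. 1.4.3; [Greenberg2016Selmer] Prop. 4.1.1 (c),
§4.3; [Greenberg2006] Thm. 3, Props. 3.2, 4.1, 4.2, §5 A; [MilneADT2006] I Thm. 4.10 (a); [KellerYin2024] §1.4 (e); [Brink2007] Thm. 2.
-/

set_option autoImplicit false
set_option linter.dupNamespace false -- the summit namespace `…BirchSwinnertonDyer.BirchSwinnertonDyer.Theorems` (Sub = Summit, D-0017) trips it

noncomputable section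

open scoped Classical
open NumberField IsDedekindDomain Field Multiplicative PowerSeries Finset
open Literature.NumberTheory.EllipticCurves Literature.NumberTheory.EllipticCurves.GreenbergSelmer
  Literature.NumberTheory.EllipticCurves.GreenbergVatsal2000 Literature.NumberTheory.GaloisRepresentations
  Literature.NumberTheory.EllipticCurves.KellerYin2024 Literature.NumberTheory.EllipticCurves.IwasawaDual
  Literature.NumberTheory.EllipticCurves.CastellaGrossiLeeSkinner2022
  Literature.NumberTheory.IwasawaTheory Literature.NumberTheory.IwasawaTheory.Greenberg2016
  Literature.NumberTheory.IwasawaTheory.Greenberg2006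
  Summit.BirchSwinnertonDyer.BirchSwinnertonDyer.Theorems
  Summit.BirchSwinnertonDyer.BirchSwinnertonDyer.Theorems.GreenbergFullAtSelmer
  Summit.BirchSwinnertonDyer.BirchSwinnertonDyer.Theorems.AcTwistDeformation
  Summit.BirchSwinnertonDyer.BirchSwinnertonDyer.Theorems.AcTwistDeformationResidualPair
  Summit.BirchSwinnertonDyer.BirchSwinnertonDyer.Theorems.CharGrSelmerCorankGeOfFacts

namespace Summit.BirchSwinnertonDyer.BirchSwinnertonDyer.Theorems.GrDualNoPTorsion

variable {K : Type} [Field K] [NumberField K] {p : ℕ} [hp : Fact p.Prime]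

/-- **`𝔛_θ^S` HAS NO `p`-TORSION (CGLS 2022 Prop. 1.2.5, «`𝔛_θ^S` is a free ℤ_p-module»), h411-free.** For `p` odd, `K` imaginary quadratic with
`(p) = v v̄` split, `κ` anticyclotomic with topological generator `γ`, `𝔭 = v̄ ∋ p`, a Teichmüller-valued character `θ : Γ_K → GL₁(𝒪)`
(`θ(σ)^{p−1} = 1`) whose residual character is unramified outside `S ∪ {w ∣ p}` (`S` a finset of places prime to `p` over rational primes SPLIT
in `K` — CGLS's «conductor only divisible by primes split in `K`»), and ANY strict dual datum `D` of `H¹_{𝓕_Gr^S}(K_∞, (F/𝒪)(θ))`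
(`KellerYin2024.GrDualData`, CGLS's `𝔛_θ^S`) that is finitely generated, `Λ`-torsion with `μ(D.X) = 0`: `p • x = 0 ⟹ x = 0` on `D.X` —
GRANTED, by name, Milne ADT I Thm. 4.10 (a) at the finite place sets of totally complex fields (`hX`) and Greenberg 2006 Props. 4.1, 4.2, 3.2
(`h41`, `h42`, `h32`). Proof: the character's twist deformation over `G_{K,Σ}`, `Σ = {v, v̄} ∪ S` (`θ` is unramified outside `Σ`:
`ramificationSubgroup_le_ker_unitChar_of_forall_inertia`; σ-supply at `Σ` by class field theory above `p` and Brink 2007 at the split `S`);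
`corank_Λ S_{𝓛^{v̄}}(K, 𝐃₁(θ)) = 0` from `D` (`hasCorank_strictAtSelmer_zero_of_grDualData`); `S_{𝓛^{v̄}}` almost divisible
(`bigRep_strictAtSelmer_isAlmostDivisible_of_dualBasis_ofPoitouTateAt`, rank one: Pontryagin dual basis of `ℚ_p/ℤ_p`, local `h⁰ = 0` and LOC⁽¹⁾
from the scalar action); conclude by `grDualData_eq_zero_of_smul_eq_zero_of_isAlmostDivisible`. No genericity of `θ` at `v̄` is needed.
[cite: CastellaGrossiLeeSkinner2022, §1.2 Prop. 1.2.5 and its proof via Greenberg 1989 Prop. 5, Greenberg–Vatsal 2000 Lem. 2.6, Prop. w = v (iii); ℤ_p-freeness explicit only in arXiv:2008.02571v1, proof of Prop. 14]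
[cite: Greenberg2016Selmer, Prop. 4.1.1 (c) (§4.1 p. 15 L21–32), §4.3 pp. 20–21] [cite: Greenberg2006, Thm. 3, Props. 3.2, 4.1, 4.2, §5 A]
[cite: MilneADT2006, I Thm. 4.10 (a) (p. 57)] [cite: Brink2007, Thm. 2] [cite: KellerYin2024, §1.4 (e) (arXiv:2402.12781v2 TeX L1162–1181)] -/
theorem grDual_smul_eq_zero_imp_ofPoitouTateAt
    (hX : ∀ (L : Type) [Field L] [NumberField L] [IsTotallyComplex L] (S : Set (HeightOneSpectrum (𝓞 L))),
      S.Finite → Literature.NumberTheory.GaloisCohomology.poitouTate_shaRestricted_tateDual_natural_at L S)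
    (h41 : prop41_globalEulerPoincareCorank) (h42 : prop42_localEulerPoincareCorank)
    (h32 : prop32_cohomology_isCofinitelyGenerated)
    (hK : IsImaginaryQuadratic K) (hp2 : p ≠ 2) (hsplit : ((Ideal.span {(p : ℤ)}).primesOver (𝓞 K)).ncard = 2)
    (κ : ZpExtension K p) (hκ : κ.IsAnticyclotomic) (γ : absoluteGaloisGroup K) [hγ : Fact (κ.IsTopGenerator γ)]
    (𝔭 : HeightOneSpectrum (𝓞 K)) (h𝔭 : ((p : ℕ) : 𝓞 K) ∈ 𝔭.asIdeal)
    (θ : FramedGaloisRep K (padicCoeffIntegers (∅ : Set (PadicAlgCl p))) 1)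
    (hθ : ∀ σ : absoluteGaloisGroup K, θ σ ^ (p - 1) = 1)
    (S : Finset (HeightOneSpectrum (𝓞 K)))
    (hSmem : ∀ v ∈ S, ((p : ℕ) : 𝓞 K) ∉ v.asIdeal ∧ ((v.asIdeal.under ℤ).primesOver (𝓞 K)).ncard = 2)
    (hunr : ∀ v : HeightOneSpectrum (𝓞 K), v ∉ S → ((p : ℕ) : 𝓞 K) ∉ v.asIdeal →
      ∀ x ∈ inertia v, ∀ m : charModule (∅ : Set (PadicAlgCl p)) θ, p • m = 0 → x • m = m)
    (D : GrDualData κ (charModule (∅ : Set (PadicAlgCl p)) θ) 𝔭 (↑S : Set (HeightOneSpectrum (𝓞 K))) γ)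
    [hDfin : Module.Finite (IwasawaAlgebra p) D.X] (hDtor : Module.IsTorsion (IwasawaAlgebra p) D.X)
    (hμ : muInvariant p D.X = 0) (x : D.X) (hx : p • x = 0) : x = 0 := by
  have hp : 2 < p := lt_of_le_of_ne hp.out.two_le (Ne.symm hp2)
  -- the partner prime `v ∣ p`, `v ≠ 𝔭 = v̄`
  obtain ⟨v, hv, hne⟩ := exists_other_prime_of_ncard_primesOver_eq_two (p := p) hsplit 𝔭 h𝔭
  have hSfp : ∀ w ∈ S, ((p : ℕ) : 𝓞 K) ∉ w.asIdeal := fun w hw ↦ (hSmem w hw).1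
  -- every `w ∈ S` is finitely decomposed in `K_∞` (Brink)
  have hdec : ∀ w ∈ S, ∃ δ ∈ decomp (K := K) w, κ δ ≠ 1 := fun w hw ↦
    exists_mem_decomp_apply_ne_one_of_ncard_primesOver_under hK hp2 κ hκ w (hSmem w hw).1 (hSmem w hw).2
  -- `Σ = {v, v̄} ∪ S` contains the places above `p`; `Σ ∩ {w ∤ p} = S`
  set Sig : Set (HeightOneSpectrum (𝓞 K)) := (↑(insert v (insert 𝔭 S)) : Set (HeightOneSpectrum (𝓞 K))) with hSigdef
  have hS : ∀ w : HeightOneSpectrum (𝓞 K), ((p : ℕ) : 𝓞 K) ∈ w.asIdeal → w ∈ Sig :=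
    mem_insert_insert_of_natCast_mem hK hv h𝔭 hne S
  have hSfS : ∀ w ∈ S, w ∈ Sig := fun w hw ↦ by
    rw [hSigdef, Finset.coe_insert, Finset.coe_insert]
    exact Or.inr (Or.inr (Finset.mem_coe.mpr hw))
  have hSf₁ : (↑S : Set (HeightOneSpectrum (𝓞 K))) ⊆ Sig := fun w hw ↦ hSfS w (Finset.mem_coe.mp hw)
  have hSf₂ : ∀ w ∈ Sig, ((p : ℕ) : 𝓞 K) ∉ w.asIdeal → w ∈ (↑S : Set (HeightOneSpectrum (𝓞 K))) := by
    intro w hw hpw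
    rw [hSigdef, Finset.coe_insert, Finset.coe_insert] at hw
    rcases hw with rfl | rfl | hw
    · exact absurd hv hpw
    · exact absurd h𝔭 hpw
    · exact hw
  have hSigfin : Sig.Finite := Finset.finite_toSet _
  -- `θ` is unramified outside `Σ`
  have h : ramificationSubgroup K Sig ≤ (unitChar θ).toMonoidHom.ker :=
    ramificationSubgroup_le_ker_unitChar_of_forall_inertia θ hθ _ fun w hw ↦
      hunr w (fun hwS ↦ hw (hSfS w hwS)) (fun hwp ↦ hw (hS w hwp))
  -- the `σ`-supply at every place of `Σ`
  have hsup : ∀ w ∈ Sig, ∃ σ : absoluteGaloisGroup (Place.Completion (Sum.inr w : Place K)), κ (absGaloisRestrict K _ σ) ≠ 1 := by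
    intro w hw
    rw [hSigdef, Finset.coe_insert, Finset.coe_insert] at hw
    rcases hw with rfl | rfl | hw
    · exact exists_local_apply_ne_one_of_natCast_mem hK κ hv
    · exact exists_local_apply_ne_one_of_natCast_mem hK κ h𝔭
    · exact exists_local_apply_ne_one_of_exists_mem_decomp κ (hdec w (Finset.mem_coe.mp hw))
  -- the canonical (discrete) topological instances of the model
  letI tΛ : TopologicalSpace (PowerSeries ℤ_[p]) := ⊥
  haveI : DiscreteTopology (PowerSeries ℤ_[p]) := ⟨rfl⟩
  haveI : IsTopologicalRing (PowerSeries ℤ_[p]) := inferInstance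
  haveI hAdisc : DiscreteTopology (QpModZp p) := QpModZp.discreteTopology p
  haveI : IsTopologicalAddGroup (BigRepModule ℤ_[p] p (QpModZp p)) := inferInstance
  haveI : ContinuousSMul (PowerSeries ℤ_[p]) (BigRepModule ℤ_[p] p (QpModZp p)) := inferInstance
  -- the model `ρ_θ` on `ℚ_p/ℤ_p`, `ψ = (charModuleEquiv θ)⁻¹`, the Shapiro descent `F`
  set ρ₀ := characterRepUnramified Sig θ h with hρ₀
  have hψ := charModuleEquiv_symm_galois Sig θ h
  obtain ⟨F, hF⟩ := exists_shapiroDescent _ hS κ ρ₀ (charModuleEquiv θ).symm hψ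
  have hA : ∀ a : QpModZp p, ∃ k : ℕ, p ^ k • a = 0 := fun a ↦ QpModZp.exists_pow_nsmul_eq_zero (p := p) a
  have hM := exists_pow_smul_cofree_eq_zero (∅ : Set (PadicAlgCl p)) θ
  have hstab := isOpen_stabilizer_cofree (∅ : Set (PadicAlgCl p)) θ
  have hscalar := characterRepUnramified_hscalar Sig θ h
  -- the specification `𝓛^{v̄}` ("`0` at `v̄`, `⊤` elsewhere"), as a term (no definition)
  let L : Specification Sig (bigRep (κ.liftUnramifiedOutside Sig hS) ρ₀) := fun w ↦ if w = Sum.inr 𝔭 then ⊥ else ⊤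
  have hL : ∀ w : Place K, L w = if w = Sum.inr 𝔭 then ⊥ else ⊤ := fun w ↦ rfl
  -- `corank_Λ S_{𝓛^{v̄}}(K, 𝐃₁(θ)) = 0` from the cotorsion of `D` (generic Shapiro, this seat)
  have hSel : HasCorank (PowerSeries ℤ_[p]) L.selmer 0 :=
    hasCorank_strictAtSelmer_zero_of_grDualData Sig hS κ ρ₀ hA (charModuleEquiv θ).symm hψ hM hstab h𝔭
      (↑S : Set (HeightOneSpectrum (𝓞 K))) hSf₁ hSf₂ hF L hL D hDfin hDtor
  -- the rank-one Pontryagin dual basis of `ℚ_p/ℤ_p` (as a `Fin 1`-family) and the generator into `K̄ˣ`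
  obtain ⟨-, jQ, -, hinjQ, hsurjQ⟩ :=
    QpModZp.exists_character_hinj_hsurj_of_linearEquiv (LinearEquiv.refl ℤ_[p] (QpModZp p))
  obtain ⟨jU, -, hinjU, hsurjU⟩ :=
    QpModZp.exists_unitsCarrier_hinj_hsurj_of_linearEquiv K (LinearEquiv.refl ℤ_[p] (QpModZp p))
  let jQ₁ : Fin 1 → (QpModZp p →+ AddCircle (1 : ℚ)) := fun _ ↦ jQ
  have hinjQ₁ : ∀ c : Fin 1 → ℤ_[p], (∀ a : QpModZp p, ∑ k, jQ₁ k (c k • a) = 0) → c = 0 := by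
    intro c hc
    have h0 : c 0 = 0 := hinjQ (c 0) fun a ↦ by simpa [jQ₁, Fin.sum_univ_one] using hc a
    funext k
    rw [Subsingleton.elim k 0, h0]
    rfl
  have hsurjQ₁ : ∀ φ : QpModZp p →+ AddCircle (1 : ℚ), ∃ c : Fin 1 → ℤ_[p], ∀ a : QpModZp p,
      φ a = ∑ k, jQ₁ k (c k • a) := fun φ ↦ by
    obtain ⟨c, hc⟩ := hsurjQ φ
    exact ⟨fun _ ↦ c, fun a ↦ by simpa [jQ₁, Fin.sum_univ_one] using hc a⟩
  -- local `h⁰ = 0` and LOC⁽¹⁾ at the places of `Σ` from the scalar action and the `σ`-supply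
  have hcyc : ∀ (w : Place K) (σ : absoluteGaloisGroup w.Completion), ∃ u : ℤ_[p], ∀ a : QpModZp p,
      DiscreteGaloisModule.units K (absGaloisRestrict K w.Completion σ) (jU a) = jU (u • a) :=
    fun w σ ↦ QpModZp.exists_units_apply_eq_smul K jU hsurjU _
  have hLOC1fin : ∀ w : HeightOneSpectrum (𝓞 K), w ∈ Sig →
      LOC1 Sig (bigRep (κ.liftUnramifiedOutside Sig hS) ρ₀) (Sum.inr w) := fun w hw ↦ by
    obtain ⟨σ, hσ⟩ := hsup w hw
    obtain ⟨t, ht⟩ := hscalar (localToUnramified Sig (Sum.inr w) σ)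
    obtain ⟨u, hu⟩ := hcyc (Sum.inr w) σ
    exact bigRep_LOC1 Sig hS κ ρ₀ hA jU hinjU hsurjU (Sum.inr w) σ t ht hu hσ
  have h0loc : ∀ w : HeightOneSpectrum (𝓞 K), w ∈ Sig →
      HasCorank (PowerSeries ℤ_[p]) ((localRep Sig (bigRep (κ.liftUnramifiedOutside Sig hS) ρ₀) (Sum.inr w)).H 0) 0 :=
    fun w hw ↦ by
    obtain ⟨σ, hσ⟩ := hsup w hw
    exact hasCorank_localH0_bigRep_zero Sig hS κ ρ₀ hscalar (Sum.inr w) hσ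
  -- Prop. 4.1.1 (c)'s conclusion at rank one, fed the textbook Poitou–Tate clause at `(K, Σ)`
  haveI := hK.2
  have hAD : IsAlmostDivisible (PowerSeries ℤ_[p]) L.selmer :=
    bigRep_strictAtSelmer_isAlmostDivisible_of_dualBasis_ofPoitouTateAt hS κ ρ₀ (hX K Sig hSigfin) h41 h42 h32 hSigfin hK hA
      jQ₁ hinjQ₁ hsurjQ₁ h0loc hLOC1fin hne hv h𝔭 L hL hSel
  -- Shapiro back: no finite submodule, `μ = 0` ⟹ no `p`-torsion
  exact grDualData_eq_zero_of_smul_eq_zero_of_isAlmostDivisible Sig hS κ ρ₀ hA (charModuleEquiv θ).symm hψ hM hstab h𝔭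
    (↑S : Set (HeightOneSpectrum (𝓞 K))) hSf₁ hSf₂ hF L hL hAD D hDfin hDtor hμ x hx

end Summit.BirchSwinnertonDyer.BirchSwinnertonDyer.Theorems.GrDualNoPTorsion

end
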